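import Summits.QuantumFields.BalabanUV.Beta.GAN24.GaugeReadColumnSums
import Summits.QuantumFields.BalabanUV.Beta.GAN24.GaugeReadChargeTotals
import Summits.QuantumFields.BalabanUV.Beta.GAN24.LinKerBlockTotals
import Summits.QuantumFields.BalabanUV.Beta.GAN24.CombSlotDerivativeBorderRead
import Summits.QuantumFields.BalabanUV.Beta.GAN24.WardResidualRotatedVertexTotals
import Summits.QuantumFields.BalabanUV.Beta.E3CoDressedContact
import Summits.QuantumFields.BalabanUV.Beta.RelInvBorderedHessianStep

/-!
# `BalabanUV.Beta.GAN24.WardResidualFieldTotals` — binder row G-an2-4 ∕ (CONV-C), CT-W «WC-TL» → «QR-LL», the (S) row of RULING R-gan24p1-g27-1, the plain sub-row of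
# (W-γ): **(T-F) AS A THEOREM — THE TOTAL FIELD READ WEIGHT OF THE (γ) COMB RESPONSE IS A FIXED MULTIPLE OF THE TOTAL FIELD READ WEIGHT OF THE END-POINT ROTATED VERTEX
# (α⁺)**: `W^γ_κ(ν,y′) = −2·(cVH·wVH d Lc j)·(stepScale d Lc j·Lc^{d+1})⁻¹ · W^{α⁺}_κ(ν,y′)` for EVERY level `j`, in-block root, `cE cVH cΛ`, label `y`, slot `(ν,y′)`, direction `κ`
# (road-P2 chair `b2b-balaban-gan24-p2`, gen 40, INTENT 3; leaf-06 g45 W4 (B)'s statement «`W^γ_κ = −W^{α⁺}_κ`» with its constant; E26b-exact on SDF-1)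

NOT IN PRINT; OUR BOOKKEEPING ([folklore] assembly BY NAME of: leaf-06 g44∕g45's `GaugeReadCharge.tsum_read_eq_read_colProfile` and `GaugeReadColumnSums.colSum_combResponse_eq_multRows`
(column sums of `G_j ∘ dM` = fm row totals of `G_j` × the (inr, inl) block of the slot derivative); road-P2 g39's `WardResidualRotatedVertexTotals.tsum_colH_comb_eq ∕ tsum_ite_blk_shift_eq ∕
totalWeightEnd_eq` and g40's `CombSlotDerivativeBorderRead.tsum_dM_inr_inl_mul_gaugeWt` (the block = the VH border; its `ĝ_y`-pairing = leaf-02 g47's border `dψ`-law) and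
`LinKerBlockTotals.tsum_linKerAt'` (straight contours cover every bond `Lc` times); an3 g30's `E3CoDressedContact.sum_tsum_colH_mul_linKerAt_of_EMA_border` («`Q′ ∘ colH G_j = δ∕(σ_j·Lc^{d+1})`»)
over an2's `relInv_coDressKBmAt_KInvStep_bhKStepAt`; Mathlib's `Fintype.card_filter_piFinset_const_eq_of_mem` for the exit-slice count `Lc^d`; 0 `def`, 0 cited fact, 0 `def … : Prop`, 0 sorry).
HONEST FRAMING (cell contract, verbatim): «discharging `BetaPertH` makes Bałaban's UV stability UNCONDITIONAL — a real constructive-QFT result; it is NOT the continuum limit and NOT the Clay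
problem.»  HONEST DEPENDENCY (verbatim): «continuum YM on T⁴ ⇐ BetaPertH ∧ nine spine estimates (0/9 proved); BetaPertH ⇐ (D1) ∧ (D4) ∧ CAP+tail; G-an2-4 gates asym, D1 and NE2/3/4.»

OBJECTS (`d + 1` dimensions, `Lc ≥ 1`, in-block root `ρ = toSite r`): `G_j = coDressKBmAt ρ Lc (KInvStep Lc j)`, `S_j = SpureRecAt …`, `M1_j = M1At …`, the slot derivative
`D = dM G_j Lc S_j M1_j ν y′`, the (γ) comb response kernel `A_j(ν,y′) = G_j ∘ D` (leaf-06's `GaugeReadChargeComb` family), the block pure gauge `ĝ_y = gaugeWt Lc y`.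
`W^γ_κ(ν,y′) := Σ'_u Σ'_x Σ_κ₂ A_j(ν,y′) u x (inl κ)(inl κ₂)·ĝ_y(κ₂,x)` (the (γ) total fine read weight of `GaugeReadChargeTotals.hasSum_comb_gaugeCharge_eq_totals`),
`W^{α⁺}_κ(ν,y′) := Σ'_u colH G_j ν y′ κ u·(½𝟙[y′ + e_ν = y] − ½𝟙[blk (u + e_κ) = y])` (the (α⁺) total field read weight of `WardResidualRotatedVertexTotals.totalWeightEnd_eq`).
* §1 `sum_box_ite_exit_eq` (the exit slice of a block has `Lc^d` sites), **`colTotal_eq`** (`Σ'_u colH G_j μ w κ u = 𝟙[κ = μ]·Lc^d·(stepScale d Lc j·Lc^{d+1})⁻¹` — road-P2 g39's column total EVALUATED: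
  the source mass `Lc^{d+1}·colMass` IS the KKT border constant `(σ_j·Lc)⁻¹`), `h𝕄mf_step ∕ h𝕄mm_step` (the step-`j` bordered Hessian's border block is `σ_j ·` the rooted one, its multiplier block `0`).
* §2 **`totalWeight_gamma_closed`**: `W^γ_κ(ν,y′) = (cVH·wVH_j)·𝟙-free closed form` =
  `(cVH·wVH d Lc j)·(stepScale d Lc j·Lc^{d+1})⁻¹·(Σ_{v∈box} colH G_j ν y′ κ (Lc•y + v − e_κ) − 𝟙[y′ + e_κ = y ∧ κ = ν]·Lc^d·(stepScale d Lc j·Lc^{d+1})⁻¹)`.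
* §3 **`totalWeight_gamma_eq_smul_totalWeightEnd`** — (T-F): `W^γ_κ(ν,y′) = −2·(cVH·wVH d Lc j)·(stepScale d Lc j·Lc^{d+1})⁻¹ · W^{α⁺}_κ(ν,y′)`.
* §4 **`hasSum_comb_gaugeCharge_plain`**: leaf-06's `hasSum_weighted_gaugeSup_of_slotConst` for the literal family with the field totals rewritten by §3 (the consumer's form).
* §5 **`totalWeight_gamma_eq_of_pin`**: under the DISPLAYED pin `cVH = −½·Lc^{2(d+1)}` (the engine's) the constant is `stepScale d Lc j·Lc^{d+1}` — the reciprocal of the (γ) normalisation, ε = −1.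
READING (§5 makes it a theorem under the displayed pin): with the joint (W-γ) text `(−½·(stepScale·Lc^{d+1})⁻¹)·Q^γ = ε·V⁺` (ε = −1 on SDF-1) the VH weight must be `cVH·wVH_j = −½·(stepScale d Lc j·Lc^{d+1})²`, i.e.
`cVH = −½·Lc^{2(d+1)}` — which IS the engine's pin (`gen39/wcnum` JSON: `cVH = −40.5` at D = 2, `−364.5` at D = 3); the file proves the identity for EVERY `cVH` and pins nothing.  Multiplier read weights (the `M1` half of the plain charge) are NOT treated here.
Asserts NO value of Bałaban's tables beyond their typed block structure; discharges NOTHING of (S) ∕ (Q-R) ∕ (LT) ∕ (Q-L) ∕ (C) ∕ «T2Shape» ∕ «T2Drift» ∕ (hW, hWall); NEVER «G-an2-4 closed» as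
(CONV-C); NOT D1, NOT BetaPertH, NOT continuum, NOT Clay.  2026-08-22; no existing file touched.
-/

noncomputable section

open Finset
open scoped BigOperators
open Literature.MathematicalPhysics.QuantumFieldTheory
open Literature.MathematicalPhysics.QuantumFieldTheory.Balaban1983to89
open Literature.MathematicalPhysics.QuantumFieldTheory.Balaban1983to89.Beta
open B12Sec2to5 (l1 l1_nonneg)
open ExpKernelCalculus (Site MKer Decays BiLoc VertexFamily Zl comp summable_exp_shift' tsum_exp_shift')
open AffineAveraging (box toSite)
open AveragingContours (blk off blk_block)
open AveragingHessianKernels (eq_smul_blk_of_off_eq_zero)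
open AveragingHessianKernelsRooted (linKerAt)
open OneStepResolventKernel (Fib wsum LocStencil)
open InterLevelTransport (cwsum)
open OneStepKernelFamily (KInvStep colH)
open SecondOrderResponse (dM vertexFamily_dM)
open BalabanStepJets (locStencil_mono)
open BalabanStepJetsSucc (wVH)
open RootedKernelReflection (off_zsmul)
open AxialProjector (blk_zsmul)
open Summit.QuantumFields.BalabanUV.Beta.TameKernelCalculus (Spr)
open Summit.QuantumFields.BalabanUV.Beta.ChartConjugationRelative (RelInv)
open Summit.QuantumFields.BalabanUV.Beta.AxialDressingRooted (coDressKBmAt decays_coDressKBmAt_KInvStep spr_coDressKBmAt axEc)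
open Summit.QuantumFields.BalabanUV.Beta.BorderedHessian (bhKAt bhKAt_inr_inr bhKStepAt bhKStepAt_zero bhKStepAt_succ_mf bhKStepAt_succ_mm stepScale stepScale_ne_zero stepScale_pos
  spr_KInvStep relInv_coDressKBmAt_KInvStep_bhKStepAt)
open Summit.QuantumFields.BalabanUV.Beta.SpineRooted (SpureRecAt M1At locStencil_SpureRecAt vertexFamily_M1At)
open Summit.QuantumFields.BalabanUV.Beta.AveragingWardRootedStencils (linSymAt linSymAt_inr_inl)
open Summit.QuantumFields.BalabanUV.Beta.KernelWardRelative (gaugeWt)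
open Summit.QuantumFields.BalabanUV.Beta.KernelWardResidual (abs_gaugeWt_le_one)
open Summit.QuantumFields.BalabanUV.Beta.E3CoDressedContact (sum_tsum_colH_mul_linKerAt_of_EMA_border summable_colH_mul_linKerAt)
open Summit.QuantumFields.BalabanUV.Beta.GAN24.LinT2ZeroModeStep (colMass)
open Summit.QuantumFields.BalabanUV.Beta.GAN24.GaugeReadCharge (tsum_read_eq_read_colProfile)
open Summit.QuantumFields.BalabanUV.Beta.GAN24.GaugeReadChargeComb (exists_vertexFamily_combResponse)
open Summit.QuantumFields.BalabanUV.Beta.GAN24.GaugeReadChargeTotals (hasSum_weighted_gaugeSup_of_slotConst)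
open Summit.QuantumFields.BalabanUV.Beta.GAN24.GaugeReadColumnSums (colSum_combResponse_eq_multRows)
open Summit.QuantumFields.BalabanUV.Beta.GAN24.WardResidualRotatedVertexTotals (tsum_colH_comb_eq tsum_ite_blk_shift_eq totalWeightEnd_eq)
open Summit.QuantumFields.BalabanUV.Beta.GAN24.CombSlotDerivativeBorderRead (tsum_dM_inr_inl_mul_gaugeWt abs_tsum_apply_le tsum_sum_tsum_sum_mul_mul_eq tsum_coarse_of_off)
open Summit.QuantumFields.BalabanUV.Beta.GAN24.LinKerBlockTotals (tsum_linKerAt' summable_linKerAt)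

namespace Summit.QuantumFields.BalabanUV.Beta.GAN24.WardResidualFieldTotals

variable {d Lc : ℕ} [NeZero Lc]

/-! ## §1 Constants, counts and bookkeeping lemmas -/

omit [NeZero Lc] in
/-- [folklore] **THE EXIT SLICE OF A BLOCK HAS `Lc^d` SITES**: `Σ_{v ∈ box} 𝟙[v_κ = Lc − 1]·c = Lc^d·c` (Mathlib's `Fintype.card_filter_piFinset_const_eq_of_mem`). -/
theorem sum_box_ite_exit_eq (hLc : 1 ≤ Lc) (κ : Fin (d + 1)) (c : ℝ) :
    ∑ v ∈ box (d + 1) Lc, (if ((v κ : ℕ) : ℤ) = (Lc : ℤ) - 1 then c else 0) = (Lc : ℝ) ^ d * c := by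
  classical
  have e : ∀ v : Fin (d + 1) → ℕ, (((v κ : ℕ) : ℤ) = (Lc : ℤ) - 1) ↔ v κ = Lc - 1 := fun v => by omega
  rw [← Finset.sum_filter]
  rw [Finset.filter_congr (fun v _ => e v), Finset.sum_const, nsmul_eq_mul]
  have hmem : Lc - 1 ∈ Finset.range Lc := Finset.mem_range.mpr (by omega)
  have h := Fintype.card_filter_piFinset_const_eq_of_mem (ι := Fin (d + 1)) (Finset.range Lc) κ hmem
  rw [Finset.card_range, Fintype.card_fin, Nat.add_sub_cancel] at h
  have hbox : box (d + 1) Lc = Fintype.piFinset fun _ : Fin (d + 1) => Finset.range Lc := rfl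
  rw [hbox]
  have h' : (Finset.filter (fun v : Fin (d + 1) → ℕ => v κ = Lc - 1) (Fintype.piFinset fun _ : Fin (d + 1) => Finset.range Lc)).card = Lc ^ d := by
    convert h using 2
  rw [h', Nat.cast_pow]

/-- NOT IN PRINT; OUR BOOKKEEPING.  **THE COLUMN TOTAL EVALUATED**: road-P2 g39's `tsum_colH_comb_eq` with the exit-slice count and `colMass` unfolded —
`Σ'_u colH G_j Lc μ w κ u = 𝟙[κ = μ]·Lc^d·(stepScale d Lc j·Lc^{d+1})⁻¹`: the source mass `Lc^{d+1}·(Lc^{j+1})^{−(d+2)}` IS `(σ_j·Lc)⁻¹`, `σ_j = stepScale d Lc j = (Lc^j)^{d+2}`. -/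
theorem colTotal_eq (hLc : 1 ≤ Lc) {r : Fin (d + 1) → ℕ} (hr : r ∈ box (d + 1) Lc) (j : ℕ) (μ κ : Fin (d + 1)) (w : Fin (d + 1) → ℤ) :
    ∑' u, colH (coDressKBmAt (toSite r) Lc (KInvStep (d := d) Lc j)) Lc μ w κ u
      = if κ = μ then (Lc : ℝ) ^ d * (stepScale d Lc j * (Lc : ℝ) ^ (d + 1))⁻¹ else 0 := by
  rw [tsum_colH_comb_eq hr j μ κ w, sum_box_ite_exit_eq hLc κ]
  simp only [colMass]
  have hL : (Lc : ℝ) ≠ 0 := by exact_mod_cast (show Lc ≠ 0 by omega)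
  by_cases h : κ = μ
  · rw [if_pos h, if_pos h]
    congr 1
    simp only [stepScale, Nat.cast_pow]
    rw [← pow_mul, ← pow_mul]
    have e : (Lc : ℝ) ^ ((j + 1) * (d + 1 + 1)) = (Lc : ℝ) * (((Lc : ℝ) ^ (j * (d + 2))) * (Lc : ℝ) ^ (d + 1)) := by
      rw [← pow_add, ← pow_succ']
      congr 1
      ring
    rw [e, mul_inv, ← mul_assoc, mul_inv_cancel₀ hL, one_mul]
  · simp [h]

/-- [folklore] The border block of the step-`j` bordered Hessian is `stepScale d Lc j ·` the rooted one (`stepScale 0 = 1`). -/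
theorem h𝕄mf_step (ρ : Fin (d + 1) → ℤ) : ∀ (j : ℕ) (x y : Fin (d + 1) → ℤ) (κ l : Fin (d + 1)),
    bhKStepAt d ρ Lc j x y (Sum.inr κ) (Sum.inl l) = stepScale d Lc j * bhKAt d ρ Lc x y (Sum.inr κ) (Sum.inl l)
  | 0, x, y, κ, l => by rw [bhKStepAt_zero]; simp [stepScale]
  | j + 1, x, y, κ, l => bhKStepAt_succ_mf j x y κ l

/-- [folklore] The multiplier block of the step-`j` bordered Hessian vanishes. -/
theorem h𝕄mm_step (ρ : Fin (d + 1) → ℤ) : ∀ (j : ℕ) (x y : Fin (d + 1) → ℤ) (κ l : Fin (d + 1)),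
    bhKStepAt d ρ Lc j x y (Sum.inr κ) (Sum.inr l) = 0
  | 0, x, y, κ, l => by rw [bhKStepAt_zero, bhKAt_inr_inr]
  | j + 1, x, y, κ, l => bhKStepAt_succ_mm j x y κ l

/-- NOT IN PRINT; OUR BOOKKEEPING.  **THE CONSTRAINT ROWS OF THE CO-DRESSED COLUMNS AT STEP `j`** (an3 g30's `sum_tsum_colH_mul_linKerAt_of_EMA_border` over an2's relative inverse at every step):
`Σ_κ′ Σ'_u′ colH G_j Lc ν y′ κ′ u′·linKerAt ρ Lc m w (κ′, u′) = 𝟙[w = y′ ∧ m = ν]·(stepScale d Lc j·Lc^{d+1})⁻¹`. -/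
theorem constraintRow_colH_comb (hLc : 1 ≤ Lc) {r : Fin (d + 1) → ℕ} (hr : r ∈ box (d + 1) Lc) (j : ℕ) (m ν : Fin (d + 1)) (w y' : Fin (d + 1) → ℤ) :
    ∑ κ', ∑' u', colH (coDressKBmAt (toSite r) Lc (KInvStep (d := d) Lc j)) Lc ν y' κ' u' * linKerAt (toSite r) Lc m w (κ', u')
      = if w = y' ∧ m = ν then (stepScale d Lc j * (Lc : ℝ) ^ (d + 1))⁻¹ else 0 :=
  sum_tsum_colH_mul_linKerAt_of_EMA_border hr (spr_coDressKBmAt hLc hr (spr_KInvStep (d := d) (Lc := Lc) j)) (stepScale d Lc j)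
    (stepScale_ne_zero (d := d) (Lc := Lc) j) (h𝕄mf_step (toSite r) j) (h𝕄mm_step (toSite r) j) (relInv_coDressKBmAt_KInvStep_bhKStepAt hr j).EMA m ν w y'

/-! ## §2 The (γ) total field read weight in closed form -/

/-- NOT IN PRINT; OUR BOOKKEEPING.  **THE (γ) TOTAL FIELD READ WEIGHT IN CLOSED FORM**: for every level `j`, in-block root, `cE cVH cΛ`, label `y`, slot `(ν,y′)`, direction `κ`,
`W^γ_κ(ν,y′) = (cVH·wVH d Lc j)·(stepScale d Lc j·Lc^{d+1})⁻¹·(Σ_{v∈box} colH G_j ν y′ κ (Lc•y + v − e_κ) − 𝟙[y′ + e_κ = y ∧ κ = ν]·Lc^d·(stepScale d Lc j·Lc^{d+1})⁻¹)`.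
ROUTE: Fubini (leaf-06 `tsum_read_eq_read_colProfile`) → column sums = fm row totals × (inr, inl) block (leaf-06 `colSum_combResponse_eq_multRows`) → Fubini (§1) → the block's `ĝ_y`-pairing =
the border `dψ`-law (road-P2 `tsum_dM_inr_inl_mul_gaugeWt`) → the packer's support reduces the middle point to the coarse lattice (`tsum_coarse_of_off`), where the row totals are
`𝟙[κ = μ]·Lc^d·(σ_j·Lc^{d+1})⁻¹` (`colTotal_eq`) → the tip indicator makes the `u′`-sum a block sum (`tsum_ite_blk_shift_eq`) whose `w`-total is `Lc^{−d}` per bond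
(`LinKerBlockTotals.tsum_linKerAt'`), and the far-endpoint indicator picks `w = y − e_κ`, where the constraint rows give the Kronecker term (`constraintRow_colH_comb`). -/
theorem totalWeight_gamma_closed (hLc : 1 ≤ Lc) {r : Fin (d + 1) → ℕ} (hr : r ∈ box (d + 1) Lc) (cE cVH cΛ : ℝ) (j : ℕ) (y : Site (d + 1)) (ν : Fin (d + 1))
    (y' : Site (d + 1)) (κ : Fin (d + 1)) :
    ∑' u, (∑' x, ∑ κ₂, comp (coDressKBmAt (toSite r) Lc (KInvStep (d := d) Lc j))
        (dM (coDressKBmAt (toSite r) Lc (KInvStep (d := d) Lc j)) Lc (SpureRecAt d Lc (toSite r) cE cVH cΛ j) (M1At d Lc (toSite r) cΛ j) ν y')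
        u x (Sum.inl κ) (Sum.inl κ₂) * gaugeWt Lc y κ₂ x)
      = (cVH * wVH d Lc j) * (stepScale d Lc j * (Lc : ℝ) ^ (d + 1))⁻¹ *
          ((∑ v ∈ box (d + 1) Lc, colH (coDressKBmAt (toSite r) Lc (KInvStep (d := d) Lc j)) Lc ν y' κ ((Lc : ℤ) • y + toSite v - Pi.single κ 1))
            - (if y' + Pi.single κ 1 = y ∧ κ = ν then (Lc : ℝ) ^ d * (stepScale d Lc j * (Lc : ℝ) ^ (d + 1))⁻¹ else 0)) := by
  classical
  -- abbreviations (by `have`-equations only; no `set`)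
  obtain ⟨CA, Cs, CM, δ, hδ, hA, hS, hM⟩ := exists_vertexFamily_combResponse hLc hr cE cVH cΛ j
  obtain ⟨δG, CG, hδG, hCG, hG⟩ := decays_coDressKBmAt_KInvStep (d := d) hr j
  -- (1) Fubini `u ↔ x`: the weight mass is the read of the column sums
  rw [tsum_read_eq_read_colProfile (hA ν y') hδ (fun κ₂ x => abs_gaugeWt_le_one Lc y κ₂ x) (Sum.inl κ)]
  -- (2) column sums = fm row totals × the (inr, inl) block of the slot derivative
  have e2 : ∀ (x : Site (d + 1)) (κ₂ : Fin (d + 1)),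
      ∑' u, comp (coDressKBmAt (toSite r) Lc (KInvStep (d := d) Lc j))
          (dM (coDressKBmAt (toSite r) Lc (KInvStep (d := d) Lc j)) Lc (SpureRecAt d Lc (toSite r) cE cVH cΛ j) (M1At d Lc (toSite r) cΛ j) ν y') u x (Sum.inl κ) (Sum.inl κ₂)
        = ∑' p, ∑ μ, (∑' u, coDressKBmAt (toSite r) Lc (KInvStep (d := d) Lc j) u p (Sum.inl κ) (Sum.inr μ))
            * dM (coDressKBmAt (toSite r) Lc (KInvStep (d := d) Lc j)) Lc (SpureRecAt d Lc (toSite r) cE cVH cΛ j) (M1At d Lc (toSite r) cΛ j) ν y' p x (Sum.inr μ) (Sum.inl κ₂) :=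
    fun x κ₂ => colSum_combResponse_eq_multRows hLc hr cE cVH cΛ j ν y' κ κ₂ x
  simp only [e2]
  -- (3) Fubini `x ↔ p`: bounded row totals against the bi-localised slot derivative read by `ĝ_y`
  obtain ⟨Cs', δs, hδs, hS'⟩ := locStencil_SpureRecAt (d := d) (Lc := Lc) hLc hr cE cVH cΛ j
  have hCs' : 0 ≤ Cs' := (hS' 0 0).nonneg (Sum.inl 0)
  have hm0 : 0 < min δs δG := lt_min hδs hδG
  have hSm : LocStencil (SpureRecAt d Lc (toSite r) cE cVH cΛ j) Cs' (min δs δG) := locStencil_mono hS' hCs' (min_le_left _ _)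
  have hMm := vertexFamily_M1At (d := d) hLc hr cΛ j hm0.le
  have hV := vertexFamily_dM (N := Lc) hG hCG hSm hMm hm0 (min_le_right _ _)
  rw [tsum_sum_tsum_sum_mul_mul_eq (R := fun μ p => ∑' u, coDressKBmAt (toSite r) Lc (KInvStep (d := d) Lc j) u p (Sum.inl κ) (Sum.inr μ))
      (D := fun p x μ κ₂ => dM (coDressKBmAt (toSite r) Lc (KInvStep (d := d) Lc j)) Lc (SpureRecAt d Lc (toSite r) cE cVH cΛ j) (M1At d Lc (toSite r) cΛ j) ν y' p x (Sum.inr μ) (Sum.inl κ₂))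
      (fun μ p => abs_tsum_apply_le hG hδG p (Sum.inl κ) (Sum.inr μ)) (fun p x μ κ₂ => hV ν y' p x (Sum.inr μ) (Sum.inl κ₂)) (half_pos hm0)
      (fun κ₂ x => abs_gaugeWt_le_one Lc y κ₂ x)]
  -- (4) the block's `ĝ_y`-pairing is the border `dψ`-law
  simp only [tsum_dM_inr_inl_mul_gaugeWt hLc hr hG hδG cE cVH cΛ j ν y' y]
  -- (5) the middle point lives on the coarse lattice (the packer's support)
  rw [tsum_coarse_of_off hLc (f := fun p => ∑ μ, (∑' u, coDressKBmAt (toSite r) Lc (KInvStep (d := d) Lc j) u p (Sum.inl κ) (Sum.inr μ)) *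
      ((cVH * wVH d Lc j) * ∑ κ', ∑' u', colH (coDressKBmAt (toSite r) Lc (KInvStep (d := d) Lc j)) Lc ν y' κ' u'
        * (((if blk Lc (u' + AffineAveraging.unitVec κ') = y then (1 : ℝ) else 0) - (if blk Lc (p + toSite r + (Lc : ℤ) • AffineAveraging.unitVec μ) = y then (1 : ℝ) else 0))
          * linSymAt (toSite r) Lc p u' (Sum.inr μ) (Sum.inl κ')))) (fun p hp => by
      refine Finset.sum_eq_zero fun μ _ => ?_
      have h0 : ∀ u' κ', linSymAt (toSite r) Lc p u' (Sum.inr μ) (Sum.inl κ') = 0 := fun u' κ' => by rw [linSymAt_inr_inl, if_neg hp]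
      simp only [h0, mul_zero, tsum_zero, Finset.sum_const_zero])]
  -- (6) at `p = Lc•w`: the packer reads `blk`, the far endpoint is `w + e_μ`, the row totals are diagonal
  have e6 : ∀ w : Site (d + 1), (∑ μ, (∑' u, coDressKBmAt (toSite r) Lc (KInvStep (d := d) Lc j) u ((Lc : ℤ) • w) (Sum.inl κ) (Sum.inr μ)) *
      ((cVH * wVH d Lc j) * ∑ κ', ∑' u', colH (coDressKBmAt (toSite r) Lc (KInvStep (d := d) Lc j)) Lc ν y' κ' u'
        * (((if blk Lc (u' + AffineAveraging.unitVec κ') = y then (1 : ℝ) else 0)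
            - (if blk Lc ((Lc : ℤ) • w + toSite r + (Lc : ℤ) • AffineAveraging.unitVec μ) = y then (1 : ℝ) else 0))
          * linSymAt (toSite r) Lc ((Lc : ℤ) • w) u' (Sum.inr μ) (Sum.inl κ'))))
      = (Lc : ℝ) ^ d * (stepScale d Lc j * (Lc : ℝ) ^ (d + 1))⁻¹ * ((cVH * wVH d Lc j) *
          ∑ κ', ∑' u', colH (coDressKBmAt (toSite r) Lc (KInvStep (d := d) Lc j)) Lc ν y' κ' u'
            * (((if blk Lc (u' + AffineAveraging.unitVec κ') = y then (1 : ℝ) else 0) - (if w + AffineAveraging.unitVec κ = y then (1 : ℝ) else 0))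
              * linKerAt (toSite r) Lc κ w (κ', u'))) := fun w => by
    have hrow : ∀ μ : Fin (d + 1), ∑' u, coDressKBmAt (toSite r) Lc (KInvStep (d := d) Lc j) u ((Lc : ℤ) • w) (Sum.inl κ) (Sum.inr μ)
        = if κ = μ then (Lc : ℝ) ^ d * (stepScale d Lc j * (Lc : ℝ) ^ (d + 1))⁻¹ else 0 := fun μ => colTotal_eq hLc hr j μ κ w
    have hfar : ∀ μ : Fin (d + 1), blk Lc ((Lc : ℤ) • w + toSite r + (Lc : ℤ) • AffineAveraging.unitVec μ) = w + AffineAveraging.unitVec μ := fun μ => by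
      rw [show (Lc : ℤ) • w + toSite r + (Lc : ℤ) • AffineAveraging.unitVec μ = (Lc : ℤ) • (w + AffineAveraging.unitVec μ) + toSite r by rw [smul_add]; abel]
      exact blk_block _ hr
    have hpack : ∀ (μ : Fin (d + 1)) (u' : Site (d + 1)) (κ' : Fin (d + 1)), linSymAt (toSite r) Lc ((Lc : ℤ) • w) u' (Sum.inr μ) (Sum.inl κ')
        = linKerAt (toSite r) Lc μ w (κ', u') := fun μ u' κ' => by
      rw [linSymAt_inr_inl, if_pos (off_zsmul Lc w), blk_zsmul hLc]
    simp only [hrow, hfar, hpack, ite_mul, zero_mul, Finset.sum_ite_eq, Finset.mem_univ, if_true]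
  simp only [e6]
  rw [tsum_mul_left, tsum_mul_left]
  -- (7) split the bracket: tip indicator (a block sum in `u′`) minus far-endpoint indicator (a point mass in `w`)
  have hsumq : ∀ (κ' : Fin (d + 1)) (u' : Site (d + 1)), Summable fun w : Site (d + 1) => linKerAt (toSite r) Lc κ w (κ', u') :=
    fun κ' u' => summable_linKerAt hLc hr κ (κ', u')
  have hcolq : ∀ (w : Site (d + 1)) (κ' : Fin (d + 1)), Summable fun u' => colH (coDressKBmAt (toSite r) Lc (KInvStep (d := d) Lc j)) Lc ν y' κ' u' * linKerAt (toSite r) Lc κ w (κ', u') :=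
    fun w κ' => summable_colH_mul_linKerAt ⟨δG, CG, hδG, hCG, hG⟩ hLc hr ν y' κ' κ w
  have e7 : ∀ w : Site (d + 1), ∑ κ', ∑' u', colH (coDressKBmAt (toSite r) Lc (KInvStep (d := d) Lc j)) Lc ν y' κ' u'
        * (((if blk Lc (u' + AffineAveraging.unitVec κ') = y then (1 : ℝ) else 0) - (if w + AffineAveraging.unitVec κ = y then (1 : ℝ) else 0))
          * linKerAt (toSite r) Lc κ w (κ', u'))
      = (∑ κ', ∑ v ∈ box (d + 1) Lc, colH (coDressKBmAt (toSite r) Lc (KInvStep (d := d) Lc j)) Lc ν y' κ' ((Lc : ℤ) • y + toSite v - AffineAveraging.unitVec κ')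
            * linKerAt (toSite r) Lc κ w (κ', (Lc : ℤ) • y + toSite v - AffineAveraging.unitVec κ'))
        - (if w + AffineAveraging.unitVec κ = y then (1 : ℝ) else 0) *
            ∑ κ', ∑' u', colH (coDressKBmAt (toSite r) Lc (KInvStep (d := d) Lc j)) Lc ν y' κ' u' * linKerAt (toSite r) Lc κ w (κ', u') := fun w => by
    rw [Finset.mul_sum, ← Finset.sum_sub_distrib]
    refine Finset.sum_congr rfl fun κ' _ => ?_
    have htip : Summable fun u' => (if blk Lc (u' + AffineAveraging.unitVec κ') = y then
        colH (coDressKBmAt (toSite r) Lc (KInvStep (d := d) Lc j)) Lc ν y' κ' u' * linKerAt (toSite r) Lc κ w (κ', u') else 0) := by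
      refine Summable.of_norm_bounded ((hcolq w κ').abs) (fun u' => ?_)
      rw [Real.norm_eq_abs]
      split_ifs
      · exact le_rfl
      · rw [abs_zero]; exact abs_nonneg _
    have e : ∀ u' : Site (d + 1), colH (coDressKBmAt (toSite r) Lc (KInvStep (d := d) Lc j)) Lc ν y' κ' u'
          * (((if blk Lc (u' + AffineAveraging.unitVec κ') = y then (1 : ℝ) else 0) - (if w + AffineAveraging.unitVec κ = y then (1 : ℝ) else 0))
            * linKerAt (toSite r) Lc κ w (κ', u'))
        = (if blk Lc (u' + AffineAveraging.unitVec κ') = y then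
            colH (coDressKBmAt (toSite r) Lc (KInvStep (d := d) Lc j)) Lc ν y' κ' u' * linKerAt (toSite r) Lc κ w (κ', u') else 0)
          - (if w + AffineAveraging.unitVec κ = y then (1 : ℝ) else 0)
            * (colH (coDressKBmAt (toSite r) Lc (KInvStep (d := d) Lc j)) Lc ν y' κ' u' * linKerAt (toSite r) Lc κ w (κ', u')) := fun u' => by
      split_ifs <;> ring
    rw [tsum_congr e, htip.tsum_sub ((hcolq w κ').mul_left _), tsum_mul_left]
    congr 1
    exact tsum_ite_blk_shift_eq hLc y (AffineAveraging.unitVec κ') _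
  simp only [e7]
  -- (8) the `w`-totals: `Lc^{−d}` per bond on the tip side; the constraint rows on the far-endpoint side
  have hP1 : Summable fun w : Site (d + 1) => ∑ κ', ∑ v ∈ box (d + 1) Lc,
      colH (coDressKBmAt (toSite r) Lc (KInvStep (d := d) Lc j)) Lc ν y' κ' ((Lc : ℤ) • y + toSite v - AffineAveraging.unitVec κ')
        * linKerAt (toSite r) Lc κ w (κ', (Lc : ℤ) • y + toSite v - AffineAveraging.unitVec κ') :=
    summable_sum fun κ' _ => summable_sum fun v _ => (hsumq κ' _).mul_left _
  have hP2 : Summable fun w : Site (d + 1) => (if w + AffineAveraging.unitVec κ = y then (1 : ℝ) else 0) *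
      ∑ κ', ∑' u', colH (coDressKBmAt (toSite r) Lc (KInvStep (d := d) Lc j)) Lc ν y' κ' u' * linKerAt (toSite r) Lc κ w (κ', u') := by
    refine summable_of_ne_finset_zero (s := {y - AffineAveraging.unitVec κ}) fun w hw => ?_
    rw [Finset.mem_singleton] at hw
    rw [if_neg (fun h => hw (by rw [← h, add_sub_cancel_right])), zero_mul]
  rw [hP1.tsum_sub hP2]
  have eP1 : ∑' w : Site (d + 1), ∑ κ', ∑ v ∈ box (d + 1) Lc,
      colH (coDressKBmAt (toSite r) Lc (KInvStep (d := d) Lc j)) Lc ν y' κ' ((Lc : ℤ) • y + toSite v - AffineAveraging.unitVec κ')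
        * linKerAt (toSite r) Lc κ w (κ', (Lc : ℤ) • y + toSite v - AffineAveraging.unitVec κ')
      = ((Lc : ℝ) ^ d)⁻¹ * ∑ v ∈ box (d + 1) Lc, colH (coDressKBmAt (toSite r) Lc (KInvStep (d := d) Lc j)) Lc ν y' κ ((Lc : ℤ) • y + toSite v - Pi.single κ 1) := by
    rw [Summable.tsum_finsetSum (fun κ' _ => summable_sum fun v _ => (hsumq κ' _).mul_left _)]
    have e : ∀ κ' : Fin (d + 1), ∑' w : Site (d + 1), ∑ v ∈ box (d + 1) Lc,
        colH (coDressKBmAt (toSite r) Lc (KInvStep (d := d) Lc j)) Lc ν y' κ' ((Lc : ℤ) • y + toSite v - AffineAveraging.unitVec κ')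
          * linKerAt (toSite r) Lc κ w (κ', (Lc : ℤ) • y + toSite v - AffineAveraging.unitVec κ')
        = if κ' = κ then ((Lc : ℝ) ^ d)⁻¹ * ∑ v ∈ box (d + 1) Lc,
            colH (coDressKBmAt (toSite r) Lc (KInvStep (d := d) Lc j)) Lc ν y' κ' ((Lc : ℤ) • y + toSite v - AffineAveraging.unitVec κ') else 0 := fun κ' => by
      rw [Summable.tsum_finsetSum (fun v _ => (hsumq κ' _).mul_left _)]
      by_cases hk : κ' = κ
      · rw [if_pos hk, Finset.mul_sum]
        refine Finset.sum_congr rfl fun v _ => ?_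
        rw [tsum_mul_left, tsum_linKerAt' hLc hr κ, if_pos hk, mul_comm]
      · rw [if_neg hk]
        refine Finset.sum_eq_zero fun v _ => ?_
        rw [tsum_mul_left, tsum_linKerAt' hLc hr κ, if_neg hk, mul_zero]
    simp only [e, Finset.sum_ite_eq', Finset.mem_univ, if_true]
    rfl
  have eP2 : ∑' w : Site (d + 1), (if w + AffineAveraging.unitVec κ = y then (1 : ℝ) else 0) *
      ∑ κ', ∑' u', colH (coDressKBmAt (toSite r) Lc (KInvStep (d := d) Lc j)) Lc ν y' κ' u' * linKerAt (toSite r) Lc κ w (κ', u')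
      = if y' + Pi.single κ 1 = y ∧ κ = ν then (stepScale d Lc j * (Lc : ℝ) ^ (d + 1))⁻¹ else 0 := by
    rw [tsum_eq_single (y - AffineAveraging.unitVec κ) (fun w hw => by rw [if_neg (fun h => hw (by rw [← h, add_sub_cancel_right])), zero_mul])]
    rw [sub_add_cancel, if_pos rfl, one_mul, constraintRow_colH_comb hLc hr j κ ν]
    have hiff : (y - AffineAveraging.unitVec κ = y' ∧ κ = ν) ↔ (y' + Pi.single κ 1 = y ∧ κ = ν) := by
      constructor
      · rintro ⟨h1, h2⟩; exact ⟨by rw [← h1]; exact sub_add_cancel _ _, h2⟩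
      · rintro ⟨h1, h2⟩; exact ⟨by rw [← h1]; exact add_sub_cancel_right _ _, h2⟩
    simp only [hiff]
  rw [eP1, eP2]
  have hL : (Lc : ℝ) ^ d ≠ 0 := pow_ne_zero _ (by exact_mod_cast (show Lc ≠ 0 by omega))
  have ha : (Lc : ℝ) ^ d * ((Lc : ℝ) ^ d)⁻¹ = 1 := mul_inv_cancel₀ hL
  generalize (∑ v ∈ box (d + 1) Lc, colH (coDressKBmAt (toSite r) Lc (KInvStep (d := d) Lc j)) Lc ν y' κ ((Lc : ℤ) • y + toSite v - Pi.single κ 1)) = X at *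
  generalize (stepScale d Lc j * (Lc : ℝ) ^ (d + 1))⁻¹ = b at *
  split_ifs with h
  · linear_combination ((cVH * wVH d Lc j) * b * X) * ha
  · linear_combination ((cVH * wVH d Lc j) * b * X) * ha

/-! ## §3 (T-F): the (γ) total is a fixed multiple of the (α⁺) total -/

/-- NOT IN PRINT; OUR BOOKKEEPING.  **(T-F) AS A THEOREM**: for every level `j`, in-block root, `cE cVH cΛ`, label `y`, slot `(ν, y′)` and field direction `κ`,
`W^γ_κ(ν,y′) = −2·(cVH·wVH d Lc j)·(stepScale d Lc j·Lc^{d+1})⁻¹ · W^{α⁺}_κ(ν,y′)` — the (γ) total fine read weight of leaf-06's comb response family (`GaugeReadChargeTotals`) is a LEVEL-DEPENDENT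
CONSTANT times the (α⁺) total field read weight of the end-point rotated vertex (road-P2 g39's `totalWeightEnd_eq`); no displayed hypothesis.  §2 against `totalWeightEnd_eq`, the two
Kronecker terms matched by `colTotal_eq` (`𝟙[y′ + e_κ = y ∧ κ = ν]` vs `𝟙[y′ + e_ν = y]·𝟙[κ = ν]`). -/
theorem totalWeight_gamma_eq_smul_totalWeightEnd (hLc : 1 ≤ Lc) {r : Fin (d + 1) → ℕ} (hr : r ∈ box (d + 1) Lc) (cE cVH cΛ : ℝ) (j : ℕ) (y : Site (d + 1))
    (ν : Fin (d + 1)) (y' : Site (d + 1)) (κ : Fin (d + 1)) :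
    ∑' u, (∑' x, ∑ κ₂, comp (coDressKBmAt (toSite r) Lc (KInvStep (d := d) Lc j))
        (dM (coDressKBmAt (toSite r) Lc (KInvStep (d := d) Lc j)) Lc (SpureRecAt d Lc (toSite r) cE cVH cΛ j) (M1At d Lc (toSite r) cΛ j) ν y')
        u x (Sum.inl κ) (Sum.inl κ₂) * gaugeWt Lc y κ₂ x)
      = (-(2 * (cVH * wVH d Lc j) * (stepScale d Lc j * (Lc : ℝ) ^ (d + 1))⁻¹)) *
          ∑' u, colH (coDressKBmAt (toSite r) Lc (KInvStep (d := d) Lc j)) Lc ν y' κ u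
            * ((if y' + Pi.single ν 1 = y then (1 / 2 : ℝ) else 0) - (if blk Lc (u + Pi.single κ 1) = y then (1 / 2 : ℝ) else 0)) := by
  rw [totalWeight_gamma_closed hLc hr cE cVH cΛ j y ν y' κ, totalWeightEnd_eq hLc hr j y ν κ y', sum_box_ite_exit_eq hLc κ]
  simp only [colMass]
  have hL : (Lc : ℝ) ≠ 0 := by exact_mod_cast (show Lc ≠ 0 by omega)
  have hσ : stepScale d Lc j ≠ 0 := stepScale_ne_zero (d := d) (Lc := Lc) j
  -- the source mass is the KKT border constant
  have hT : (Lc : ℝ) ^ d * ((Lc : ℝ) * ((((Lc ^ (j + 1) : ℕ) : ℝ)) ^ (d + 1 + 1))⁻¹) = (Lc : ℝ) ^ d * (stepScale d Lc j * (Lc : ℝ) ^ (d + 1))⁻¹ := by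
    have h := colTotal_eq hLc hr j κ κ 0
    rw [tsum_colH_comb_eq hr j κ κ 0, sum_box_ite_exit_eq hLc κ] at h
    simp only [colMass, if_true] at h
    exact h
  by_cases hκ : κ = ν
  · subst hκ
    simp only [and_true, if_true]
    rw [hT]
    split_ifs <;> ring
  · simp only [hκ, if_false, and_false, mul_zero, sub_zero, zero_sub]
    ring

/-! ## §4 The consumer's form: the plain (γ) charge per slot with the field totals replaced -/

/-- NOT IN PRINT; OUR BOOKKEEPING.  **THE (γ) ω-CHARGE OF THE COMB LETTER AGAINST SLOT-CONSTANT TABLE CHARGES, FIELD HALF IN (α⁺) CURRENCY**: leaf-06 g45's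
`GaugeReadChargeTotals.hasSum_weighted_gaugeSup_of_slotConst` for the literal family, with every field total `W^γ_κ(ν,y′)` rewritten by (T-F) as `−2·(cVH·wVH_j)·(σ_j·Lc^{d+1})⁻¹·W^{α⁺}_κ(ν,y′)`;
the multiplier totals (coarse read weights × `ζM`) are left as they are (in the flat class the `M1` charges vanish on the engine, E26g — not typed here). -/
theorem hasSum_comb_gaugeCharge_plain (hLc : 1 ≤ Lc) {r : Fin (d + 1) → ℕ} (hr : r ∈ box (d + 1) Lc) (cE cVH cΛ : ℝ) (j : ℕ) (y : Site (d + 1)) (ν : Fin (d + 1))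
    (y' : Site (d + 1)) (a b : Fib d) {ω : Site (d + 1) × Site (d + 1) → ℝ} {B : ℝ} (hω : ∀ xz, |ω xz| ≤ B) {ζS ζM : Fin (d + 1) → ℝ}
    (hζS : ∀ κ u, ∑' xz : Site (d + 1) × Site (d + 1), ω xz * SpureRecAt d Lc (toSite r) cE cVH cΛ j κ u xz.1 xz.2 a b = ζS κ)
    (hζM : ∀ ρ' w, ∑' xz : Site (d + 1) × Site (d + 1), ω xz * M1At d Lc (toSite r) cΛ j ρ' w xz.1 xz.2 a b = ζM ρ') :
    HasSum (fun xz : Site (d + 1) × Site (d + 1) => ω xz *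
        (∑ κ, wsum (fun u => ∑' x₂, ∑ κ₂,
              comp (coDressKBmAt (toSite r) Lc (KInvStep (d := d) Lc j))
                (dM (coDressKBmAt (toSite r) Lc (KInvStep (d := d) Lc j)) Lc (SpureRecAt d Lc (toSite r) cE cVH cΛ j) (M1At d Lc (toSite r) cΛ j) ν y')
                u x₂ (Sum.inl κ) (Sum.inl κ₂) * gaugeWt Lc y κ₂ x₂) (SpureRecAt d Lc (toSite r) cE cVH cΛ j κ)
          + ∑ ρ', cwsum Lc (fun w => ∑' x₂, ∑ κ₂,
              comp (coDressKBmAt (toSite r) Lc (KInvStep (d := d) Lc j))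
                (dM (coDressKBmAt (toSite r) Lc (KInvStep (d := d) Lc j)) Lc (SpureRecAt d Lc (toSite r) cE cVH cΛ j) (M1At d Lc (toSite r) cΛ j) ν y')
                ((Lc : ℤ) • w) x₂ (Sum.inr ρ') (Sum.inl κ₂) * gaugeWt Lc y κ₂ x₂) (M1At d Lc (toSite r) cΛ j ρ')) xz.1 xz.2 a b)
      (∑ κ, ((-(2 * (cVH * wVH d Lc j) * (stepScale d Lc j * (Lc : ℝ) ^ (d + 1))⁻¹)) *
            ∑' u, colH (coDressKBmAt (toSite r) Lc (KInvStep (d := d) Lc j)) Lc ν y' κ u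
              * ((if y' + Pi.single ν 1 = y then (1 / 2 : ℝ) else 0) - (if blk Lc (u + Pi.single κ 1) = y then (1 / 2 : ℝ) else 0))) * ζS κ
        + ∑ ρ', (∑' w, ∑' x₂, ∑ κ₂,
              comp (coDressKBmAt (toSite r) Lc (KInvStep (d := d) Lc j))
                (dM (coDressKBmAt (toSite r) Lc (KInvStep (d := d) Lc j)) Lc (SpureRecAt d Lc (toSite r) cE cVH cΛ j) (M1At d Lc (toSite r) cΛ j) ν y')
                ((Lc : ℤ) • w) x₂ (Sum.inr ρ') (Sum.inl κ₂) * gaugeWt Lc y κ₂ x₂) * ζM ρ') := by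
  obtain ⟨CA, Cs, CM, δ, hδ, hA, hS, hM⟩ := exists_vertexFamily_combResponse hLc hr cE cVH cΛ j
  have h := hasSum_weighted_gaugeSup_of_slotConst (hA ν y') hδ (fun κ x => abs_gaugeWt_le_one Lc y κ x) hLc hS hM a b hω hζS hζM
  simp only [totalWeight_gamma_eq_smul_totalWeightEnd hLc hr cE cVH cΛ j y ν y'] at h
  exact h

/-! ## §5 Under the engine's VH pin the constant is the (γ) normalisation -/

/-- NOT IN PRINT; OUR BOOKKEEPING.  **(T-F) UNDER THE DISPLAYED VH PIN `cVH = −½·Lc^{2(d+1)}`** (the value the OWNER's engine SDF-1 uses: `gen39/wcnum` JSON pins `cVH = −40.5 = −½·3⁴` at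
`D = 2`, `−364.5 = −½·3⁶` at `D = 3`, next to `cE = Lc^{d+1}`): the constant collapses to `stepScale d Lc j·Lc^{d+1}`, i.e. `W^γ_κ(ν,y′) = (σ_j·Lc^{d+1})·W^{α⁺}_κ(ν,y′)` — so the (γ)
normalisation `−½·(σ_j·Lc^{d+1})⁻¹` of the joint (W-γ) text turns the plain field charge of (γ) into MINUS the (α⁺) one (ε = −1, E26b).  The pin is a HYPOTHESIS here; nothing is pinned. -/
theorem totalWeight_gamma_eq_of_pin (hLc : 1 ≤ Lc) {r : Fin (d + 1) → ℕ} (hr : r ∈ box (d + 1) Lc) (cE cVH cΛ : ℝ) (hpin : cVH = -(1 / 2 : ℝ) * (Lc : ℝ) ^ (2 * (d + 1)))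
    (j : ℕ) (y : Site (d + 1)) (ν : Fin (d + 1)) (y' : Site (d + 1)) (κ : Fin (d + 1)) :
    ∑' u, (∑' x, ∑ κ₂, comp (coDressKBmAt (toSite r) Lc (KInvStep (d := d) Lc j))
        (dM (coDressKBmAt (toSite r) Lc (KInvStep (d := d) Lc j)) Lc (SpureRecAt d Lc (toSite r) cE cVH cΛ j) (M1At d Lc (toSite r) cΛ j) ν y')
        u x (Sum.inl κ) (Sum.inl κ₂) * gaugeWt Lc y κ₂ x)
      = (stepScale d Lc j * (Lc : ℝ) ^ (d + 1)) *
          ∑' u, colH (coDressKBmAt (toSite r) Lc (KInvStep (d := d) Lc j)) Lc ν y' κ u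
            * ((if y' + Pi.single ν 1 = y then (1 / 2 : ℝ) else 0) - (if blk Lc (u + Pi.single κ 1) = y then (1 / 2 : ℝ) else 0)) := by
  rw [totalWeight_gamma_eq_smul_totalWeightEnd hLc hr cE cVH cΛ j y ν y' κ]
  congr 1
  have hL : (Lc : ℝ) ≠ 0 := by exact_mod_cast (show Lc ≠ 0 by omega)
  rw [hpin]
  simp only [wVH, stepScale, ← pow_mul]
  field_simp
  ring

end Summit.QuantumFields.BalabanUV.Beta.GAN24.WardResidualFieldTotals

end
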